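import Mathlib.Geometry.Manifold.Instances.Sphere
import Literature.Geometry.Lorentzian.Volume
import Literature.Geometry.Lorentzian.PseudoRiemannianMetric
import Literature.Geometry.Lorentzian.LeviCivita
import HarnessLib

/-!
# Karpukhin–Stern: ground-state harmonic maps to spheres exist for every metric (dims 3–5)
(topic `Geometry/Riemannian`)

Named fact for route SmoothPoincare4/SpectralDevelopingMap (crux `EveryMetricHearsSphere`,
item stmt-SmoothPoincare4-7413; also the language of `GroundStateMapsUnfold`, stmt-7412), READ on
the arXiv text arXiv:2207.13635 (= Invent. Math. 236 (2024) 713–778), pp. 4 and 6: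

* **Corollary 1.3** (p. 4, verbatim): "For any closed manifold `(Mⁿ, g)` of dimension `n ⩾ 3` and
  any `k ⩾ 3`, there is a nonconstant stationary harmonic map `u_k : Mⁿ → Sᵏ` of Morse index
  `ind_E(u_k) ⩽ k + 1`, smooth away from a closed set `Σ ⊂ M` of dimension `dim(Σ) ⩽ n − k − 1`
  if `3 ⩽ k ⩽ 5`, … In particular, if `3 ⩽ n ⩽ 5`, then `u_k : Mⁿ → Sᵏ` is smooth for all
  `k ⩾ n`."
* **Theorem 1.5** (p. 6, verbatim): "On any closed Riemannian manifold `(Mⁿ, g)` of dimension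
  `3 ⩽ n ⩽ 5`, for `k ⩾ k(M, g)` sufficiently large, the energy densities `e(u_k) = |du_k|²_g` of
  the smooth harmonic maps `u_k` constructed in Corollary 1.3 realize `V₁(M, g)`. Namely, the
  components of `u_k` are `λ₁(Mⁿ, g, e(u_k))`-eigenfunctions, `λ₁(Mⁿ, g, e(u_k)) = 1` and
  `V₁(M, g) = 2E(u_k)`."  Here (p. 5) `0 = λ₀(M,g,β) < λ₁(M,g,β) < …` are the eigenvalues of the
  weighted problem `Δ_g f = λ β f` (positive Laplacian `Δ_g = −tr_g Hess`), so that
  "`λ₁(M, g, e(u)) = 1`" reads variationally: `∫ e(u) f dv_g = 0 ⇒ ∫ e(u) f² dv_g ≤ ∫ |df|²_g dv_g`,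
  and "the components `uᵢ` are `λ₁`-eigenfunctions" reads `Δ_g uᵢ = e(u) uᵢ`, i.e.
  `tr_g Hess uᵢ = −e(u) uᵢ` — the harmonic-map equation into the round sphere.

## Lean rendering (vocabulary of the route file, no new notions)

`M : Type` a Hausdorff second-countable `C^∞` `n`-manifold on `EuclideanSpace ℝ (Fin n)`,
compact and connected ("closed"; connectedness is implicit in print and only weakens the fact),
with `[T3Space M] [MeasurableSpace M] [BorelSpace M]` for the Riemannian measure
`Literature.Geometry.Lorentzian.riemannianMeasure g` (`Volume.lean`); `g` a Mathlib
`Bundle.ContMDiffRiemannianMetric`, read through `PseudoRiemannianMetric.ofRiemannian g`, whose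
`dalembertian` is `tr_g Hess` (`LeviCivita.lean`) and whose `innerDual` is `g⁻¹` on covectors, so
`|df|²_g = innerDual (df, df)` with `df = mvfderiv (𝓡 n) f x` (Mathlib); the standing binder
`(ofRiemannian g).HasLeviCivita` is a THEOREM (`PseudoRiemannianMetric.hasLeviCivita`,
`LeviCivitaProofs.lean`) kept as a hypothesis to keep the import cone small, exactly as in the
route file. The target sphere `Sᵏ ⊂ ℝᵏ⁺¹` is `Metric.sphere (0 : EuclideanSpace ℝ (Fin (k+1))) 1`
with Mathlib's stereographic `C^∞` structure (`𝓡 k`). NOT recorded: the Morse-index bound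
`ind_E(u_k) ≤ k + 1`, the maximality `V₁(M,g) = 2E(u_k)` (no weighted-eigenvalue functional in
tree) and Prop. 1.4 (the image lies in a totally geodesic `S^{k₀}`). What the route's crux
`EveryMetricHearsSphere` asks BEYOND this fact: `k = n = 4` and `u` a homotopy equivalence — not
in print (KS's `k` is large and the degree/topology of `u_k` is uncontrolled).

## References

* M. Karpukhin, D. Stern, *Existence of harmonic maps and eigenvalue optimization in higher
  dimensions*, Invent. Math. 236 (2024) 713–778; arXiv:2207.13635, Cor. 1.3 (p. 4), Prop. 1.4
  (p. 4), Thm. 1.5 (p. 6), §1.3.1 (p. 5: `λ_m(M,g,β)`). [KarpukhinStern2024]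
-/

noncomputable section

open MeasureTheory
open scoped Manifold ContDiff

namespace Literature.Geometry.Riemannian

open Literature.Geometry.Lorentzian (PseudoRiemannianMetric riemannianMeasure)
open Literature.Geometry.Lorentzian.PseudoRiemannianMetric

/-- NAMED FACT (**Karpukhin–Stern 2024, Cor. 1.3 with Thm. 1.5**: "On any closed Riemannian
manifold `(Mⁿ, g)` of dimension `3 ⩽ n ⩽ 5`, for `k ⩾ k(M, g)` sufficiently large, the energy
densities `e(u_k) = |du_k|²_g` of the smooth harmonic maps `u_k` [nonconstant, `Mⁿ → Sᵏ`,
Cor. 1.3] … the components of `u_k` are `λ₁(Mⁿ, g, e(u_k))`-eigenfunctions,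
`λ₁(Mⁿ, g, e(u_k)) = 1`"). For every closed connected Riemannian `n`-manifold `(M, g)`,
`3 ≤ n ≤ 5`, there is `k₀` such that for every `k ≥ k₀` there are a nonconstant `C^∞` map
`u : M → Sᵏ ⊂ ℝᵏ⁺¹` and `e : M → ℝ` with `e = Σᵢ |duᵢ|²_g` (energy density `|du|²_g`),
`tr_g Hess uᵢ = −e · uᵢ` for every coordinate `uᵢ` (harmonic-map equation into the round sphere =
the components are eigenfunctions of `Δ_g f = λ e f` with `λ = 1`), and `λ₁(M, g, e) ≥ 1` in
Rayleigh form: every `C^∞` `f` with `∫ e f dv_g = 0` has `∫ e f² dv_g ≤ ∫ |df|²_g dv_g` — a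
GROUND-STATE MAP in the sense of route SmoothPoincare4/SpectralDevelopingMap. Grounds (partially)
`Summit.SmoothPoincare4.SmoothPoincare4.Theses.SpectralDevelopingMap.EveryMetricHearsSphere`, which
asks in addition `k = 4` and `u` a homotopy equivalence (not in print). Users take
`(h : karpukhinStern_groundStateHarmonicMap)`.
[cite: KarpukhinStern2024, Cor. 1.3 and Thm. 1.5 (arXiv:2207.13635 pp. 4, 6)] -/
def karpukhinStern_groundStateHarmonicMap : Prop :=
  ∀ (n : ℕ), 3 ≤ n → n ≤ 5 →
    ∀ (M : Type) [TopologicalSpace M] [T2Space M] [SecondCountableTopology M]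
      [ChartedSpace (EuclideanSpace ℝ (Fin n)) M] [IsManifold (𝓡 n) ∞ M] [CompactSpace M]
      [ConnectedSpace M] [T3Space M] [MeasurableSpace M] [BorelSpace M]
      (g : Bundle.ContMDiffRiemannianMetric (𝓡 n) ∞ (EuclideanSpace ℝ (Fin n))
        (TangentSpace (𝓡 n) : M → Type _))
      (_ : (ofRiemannian g).HasLeviCivita),
      ∃ k₀ : ℕ, ∀ k : ℕ, k₀ ≤ k →
        ∃ (u : M → Metric.sphere (0 : EuclideanSpace ℝ (Fin (k + 1))) 1) (e : M → ℝ),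
          ContMDiff (𝓡 n) (𝓡 k) ∞ u ∧ (∃ x y : M, u x ≠ u y) ∧
          (∀ x, e x = ∑ i : Fin (k + 1), (ofRiemannian g).innerDual x
              (mvfderiv (𝓡 n) (fun y => (u y : EuclideanSpace ℝ (Fin (k + 1))) i) x).toLinearMap
              (mvfderiv (𝓡 n) (fun y => (u y : EuclideanSpace ℝ (Fin (k + 1))) i) x).toLinearMap) ∧
          (∀ (i : Fin (k + 1)) (x : M), (ofRiemannian g).dalembertian
              (fun y => (u y : EuclideanSpace ℝ (Fin (k + 1))) i) x =
                -(e x) * (u x : EuclideanSpace ℝ (Fin (k + 1))) i) ∧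
          (∀ f : M → ℝ, ContMDiff (𝓡 n) 𝓘(ℝ, ℝ) ∞ f →
              ∫ x, e x * f x ∂(riemannianMeasure g) = 0 →
              ∫ x, e x * f x ^ 2 ∂(riemannianMeasure g) ≤
                ∫ x, (ofRiemannian g).innerDual x (mvfderiv (𝓡 n) f x).toLinearMap
                  (mvfderiv (𝓡 n) f x).toLinearMap ∂(riemannianMeasure g))

end Literature.Geometry.Riemannian

end
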